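import Summits.QuantumFields.YangMills.Theorems.BalabanUVNodesK1EndExactRowsStrictPosKick
import Summits.QuantumFields.YangMills.Theorems.BalabanUVNodesK1WindowKOfRunRowsSurvivors

/-!
# (C) IS NOT NEEDED FOR THE END EITHER — THE STEP WITNESS: END, (W), (T), rows (i) and (iv), no-shrink at EVERY level, while run-wise (C) `SurvCont` FAILS at EVERY level

Cell `pub-ymgap`, seat `pub-ymgap-dag-n13-w5` (g6), N13 [B16] width seat; `--kind proof --supports stmt-QuantumFields-27364 --as helper` (K1⁹
`…Theses.BalabanUVNodes.StabilityBRunRowsAtRecordR13SepCoPHV`, crux r3 DECIDING, route rev 29).  FILE 5 of the END-EXACTNESS census of the `dag-n13-w4` lineage, typed on that seat's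
hand-out word («n13-w5 take (e)», HOME/INBOX 2026-08-28T13:44:45Z): FILE 2 = p626836 `…K1EndExactRowsStrict` (first kick: END holds, rows (i), (iv), no-shrink FAIL), FILE 3 = p628067
`…K1EndExactRowsStrictInBox` (fading kick in the box: END + (i) + (C), row (iv) FAILS), FILE 4 = p634872 `…K1EndExactRowsStrictPosKick` (positive kick: END + (iv) + (C), row (i) FAILS;
`rowsI_IV_independent_over_END`).  Those three witnesses are box-continuous, so DEF-1's run-wise (C) `SurvCont` holds in all of them; the census (#37 on 27364, §3) located but did
not type a (C)-FREE END witness.  THIS FILE types it, in a form that keeps BOTH pressed rows of K1⁹.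

THE SHAPE (hypothesis-form on an abstract `β : HBeta`, instantiated once in §4): `hβ : β k v = 𝟙[v 0 < c k]` — at step `k` the β-function reads ONLY the bare coupling `g_0` of the
history (Gaps' `extH` shape) and equals `1` below the threshold `c k > 0`, `0` from it on; instance `c k := 1∕(k+2)`, thresholds accumulating at `0`.
Along a solution of (0.20) (`FlowStep.RGEqH`: `g_{k+1}⁻² = g_k⁻² − β_k`) started at `x`: `g_j⁻² = x⁻² − #{i < j : x < c_i}` (`inv_sq_genSeq_step`).
* floor `0`, ceiling `1` on every box ⟹ ROW (i) `RunConstRemainder β ½ ½ γ` at every level, ROW (iv) with `M = 0`, NO-SHRINK for every slack `β₀ ≥ 0` (FILE 4's `run_mono_of_nonneg`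
  BY NAME), (T) at every level (FILE 2's `topRunThresholds_of_runwisePSFloor` BY NAME), (W) at every level (file 12's `windowRuns_of_betaUpperH`, p621368, BY NAME);
* THE END of `modelOf β` BY HAND (§2): for a target `g ≤ γ` and a length `K` the bare coupling is `x_n := (g⁻² + n)^{−1∕2}` at a FIXED POINT `n = #{i < K : x_n < c_i}` of a monotone
  self-map of `{0,…,K}` (`exists_fixedPoint_of_monotone_le`); then `g_K⁻² = x_n⁻² − n = g⁻²` exactly and the run is non-decreasing, hence in `]0, γ]`.  File 12's continuity roads
  (`endpointExistence_of_windowRuns_topRuns_betaContH ∕ _survCont`) do NOT apply here, and NON-CROSSING FAILS for this family: `x ↦ g_K(x)` is increasing on each piece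
  `[c_{i+1}, c_i[` with DOWNWARD jumps at the thresholds, so two bare couplings may reach the same endpoint — exactly why the necessity half of p621368 :172 ∕ p625860 carries `hord`;
* (C) FAILS AT EVERY LEVEL (§3): by p611987 `survCont_iff_continuousOn_alongGenSeq` the trace of `β k` along the generated runs is `x ↦ 𝟙[x < c_k]` itself, and by ROW (i) + p611987
  `Ioc_subset_survivors_of_runConstRemainder_of_le` the survivor set of level `γ₀` at scale `k` contains `]0, (γ₀⁻² + k)^{−1∕2}]`, which contains the jump point `c_k` as soon as
  `c_k ≤ (γ₀⁻² + k)^{−1∕2}` — for `c_k = 1∕(k+2)` take `k ≥ γ₀⁻¹` (`exists_scale_step`).  A fortiori box continuity `BetaContH γ₀ β` fails at every level.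
CONSEQUENCE (§4, with p611987 `runRows_without_cont_not_endpointExistence` BY NAME): as LETTERS on a general `HBeta`, given BOTH pressed rows of K1⁹, DEF-1's (C) is SUFFICIENT for K2⁹'s
END (p611987 §5) and NOT NECESSARY (here) — (C) is a proof device of the END road, not an END-exact letter; the END-exact content stays {(W), (T)} + whatever selects ONE preimage.

| witness | END | (W) | (T) | (C) | row (i) | row (iv) | no-shrink | file |
|---|---|---|---|---|---|---|---|---|
| step `β k = 𝟙[g_0 < c_k]`, `c_k ↓ 0` | ✓ | ✓ | ✓ | ✗ ∀γ₀ | ✓ (b ≡ ½, r = ½) | ✓ (M = 0) | ✓ ∀β₀ ≥ 0 | this file |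

HONEST FRAMING.  [folklore] letter-level real analysis on the recursion (0.20) for an ABSTRACT `HBeta`; the witness is NOT continuous in the coupling (print [I] §1 pp. 263–264 asserts
smoothness of the true β-functions — so at `Node00.betaOfRecord₁₃ θ` (C) is expected to HOLD; nothing here says otherwise); NOTHING about `Node00.betaOfRecord₁₃`; nothing of Bałaban
asserted; no item filed ∕ closed; K1⁹ NOT closed (v10, 0∕6 stubs); N13 NOT discharged; counts UNMOVED (typed 28∕28 · discharged 5∕27 · A 5∕28).  One finite 𝕋⁴ programme at fixed ε,
Bałaban AS PRINTED; R4 = the CONDITIONAL finite-𝕋⁴ rung `BalabanLadder.UV` only — the Yang–Mills mass gap (Clay) is NOT proved by any of this; nothing continuum ∕ ℝ⁴ ∕ OS.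
No `sorry`, no `axiom`, no `def`, no `instance`, no `notation`.
Sources (context only): [I] T. Bałaban, Commun. Math. Phys. 109 (1987) 249 [Balaban1987RG1] (0.17)–(0.20) pp. 255–256, Thm 2 p. 259 (first sentence), §1 pp. 263–264, Thm 3 p. 264,
(5.10) p. 293; [III] Commun. Math. Phys. 119 (1988) 243 [Balaban1988Convergent] (2.6) p. 255.
-/

noncomputable section

open scoped BigOperators Matrix.Norms.L2Operator

namespace Summit.QuantumFields.YangMills.Theorems.BalabanUVNodesK1EndExactRowsContFreeStep

open Literature.MathematicalPhysics.QuantumFieldTheory.Balaban1983to89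
open Literature.MathematicalPhysics.QuantumFieldTheory.Balaban1983to89.FlowStep
open Literature.MathematicalPhysics.QuantumFieldTheory.Balaban1983to89.FlowStepRuns
open Literature.MathematicalPhysics.QuantumFieldTheory.Balaban1983to89.DagBinding
open Summit.QuantumFields.YangMills.Theorems.BalabanUVNodesK2NamedJetsRunRemAt (Survivors SurvCont RunConstRemainder)
open Summit.QuantumFields.YangMills.Theorems.BalabanUVNodesK1EndCriterionCeilingFree (windowRuns_of_betaUpperH)
open Summit.QuantumFields.YangMills.Theorems.BalabanUVNodesK1EndExactRowsStrict (topRunThresholds_of_runwisePSFloor)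
open Summit.QuantumFields.YangMills.Theorems.BalabanUVNodesK1EndExactRowsStrictPosKick (run_mono_of_nonneg)
open Summit.QuantumFields.YangMills.Theorems.BalabanUVNodesK1WindowKOfRunRowsSurvivors
  (Ioc_subset_survivors_of_runConstRemainder_of_le survCont_iff_continuousOn_alongGenSeq runRows_without_cont_not_endpointExistence)

/-! ## §1 The step shape: the letters that HOLD at every level — floor, ceiling, rows (i) and (iv), no-shrink, (T), (W) -/

section Step

variable {β : HBeta} {c : ℕ → ℝ}

/-- the step shape takes only the values `0` and `1`. [folklore] -/
theorem step_zero_or_one (hβ : ∀ (k : ℕ) (v : Fin (k + 1) → ℝ), β k v = if v 0 < c k then 1 else 0) (k : ℕ) (v : Fin (k + 1) → ℝ) :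
    β k v = 0 ∨ β k v = 1 := by
  rw [hβ]
  split_ifs
  · exact Or.inr rfl
  · exact Or.inl rfl

/-- `0 ≤ β` everywhere (the asymptotic-freedom SIGN, trivially). [folklore] -/
theorem step_nonneg (hβ : ∀ (k : ℕ) (v : Fin (k + 1) → ℝ), β k v = if v 0 < c k then 1 else 0) (k : ℕ) (v : Fin (k + 1) → ℝ) :
    0 ≤ β k v := by
  rcases step_zero_or_one hβ k v with h | h <;> rw [h]
  exact zero_le_one

/-- `β ≤ 1` everywhere. [folklore] -/
theorem step_le_one (hβ : ∀ (k : ℕ) (v : Fin (k + 1) → ℝ), β k v = if v 0 < c k then 1 else 0) (k : ℕ) (v : Fin (k + 1) → ℝ) :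
    β k v ≤ 1 := by
  rcases step_zero_or_one hβ k v with h | h <;> rw [h]
  exact zero_le_one

/-- **FLOOR `0` ON EVERY BOX** (`BetaLowerH 0 γ β` at every level). [cite: Balaban1987RG1, Thm 2 p.259 (first sentence) (the letter; elementary)] -/
theorem step_lower (hβ : ∀ (k : ℕ) (v : Fin (k + 1) → ℝ), β k v = if v 0 < c k then 1 else 0) (γ : ℝ) : BetaLowerH 0 γ β :=
  fun k v _ => step_nonneg hβ k v

/-- **CEILING `1` ON EVERY BOX** (`BetaUpperH 1 γ β` at every level; print's «uniformly bounded», [I] §1 p.264, as a letter). [cite: Balaban1987RG1, §1 p.264 (the letter; elementary)] -/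
theorem step_upper (hβ : ∀ (k : ℕ) (v : Fin (k + 1) → ℝ), β k v = if v 0 < c k then 1 else 0) (γ : ℝ) : BetaUpperH 1 γ β :=
  fun k v _ => step_le_one hβ k v

/-- **ROW (i) AT EVERY LEVEL** — the run-wise constant remainder with `b ≡ ½`, `r = ½`: `|β − ½| ≤ ½` since `β ∈ {0, 1}`. [cite: Balaban1987RG1, Thm 3 p.264, (5.10) p.293 (the letter; elementary)] -/
theorem step_runConstRemainder (hβ : ∀ (k : ℕ) (v : Fin (k + 1) → ℝ), β k v = if v 0 < c k then 1 else 0) (γ : ℝ) :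
    RunConstRemainder β (fun _ => 1 / 2) (1 / 2) γ := by
  intro n gs _ _ k _
  rcases step_zero_or_one hβ k (prefixOf gs k) with h | h <;> rw [h] <;> exact abs_le.mpr ⟨by norm_num, by norm_num⟩

/-- **ROW (iv) AT EVERY LEVEL with `M = 0`**: partial sums of a floor-`0` family along in-window runs are `≥ 0`. [cite: Balaban1987RG1, (0.20) p.256; Balaban1988Convergent, (2.6) p.255 (the letter; elementary)] -/
theorem step_psFloor (hβ : ∀ (k : ℕ) (v : Fin (k + 1) → ℝ), β k v = if v 0 < c k then 1 else 0) (γ : ℝ) :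
    ∀ (n : ℕ) (gs : ℕ → ℝ), RGEqH n β gs → Step.InInterval γ n gs → ∀ k, k ≤ n → -(0 : ℝ) ≤ ∑ j ∈ Finset.Ico k n, β j (prefixOf gs j) := by
  intro n gs _ _ k _
  rw [neg_zero]
  exact Finset.sum_nonneg fun j _ => step_nonneg hβ j _

/-- **NO-(1+β₀)⁻¹-SHRINK AT EVERY LEVEL FOR EVERY SLACK `β₀ ≥ 0`**: in-window runs of a floor-`0` family are non-decreasing (FILE 4's `run_mono_of_nonneg` BY NAME). [cite: Balaban1988Convergent, (2.6) p.255 (the letter; elementary)] -/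
theorem step_noShrink (hβ : ∀ (k : ℕ) (v : Fin (k + 1) → ℝ), β k v = if v 0 < c k then 1 else 0) (γ : ℝ) {β₀ : ℝ} (hβ₀ : 0 ≤ β₀) :
    ∀ (n : ℕ) (gs : ℕ → ℝ), RGEqH n β gs → Step.InInterval γ n gs → ∀ m n', m < n' → n' ≤ n → gs m ≤ (1 + β₀) * gs n' := by
  intro n gs hrg hI m n' hmn hn'
  have hle := run_mono_of_nonneg (step_lower hβ γ) hrg hI m n' hmn.le hn'
  have hpos : 0 < gs n' := (hI n' hn').1
  nlinarith

/-- **(T) AT EVERY LEVEL** — a top-run threshold from ROW (iv) with `M = 0` (FILE 2's `topRunThresholds_of_runwisePSFloor` BY NAME). [cite: Balaban1987RG1, (0.20) p.256, Thm 2 p.259 (first sentence) (elementary)] -/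
theorem step_topRuns (hβ : ∀ (k : ℕ) (v : Fin (k + 1) → ℝ), β k v = if v 0 < c k then 1 else 0) {γ : ℝ} (hγ : 0 < γ) :
    ∃ gstar : ℝ, 0 < gstar ∧ ∀ (n : ℕ) (gs : ℕ → ℝ), RGEqH n β gs → Step.InInterval γ n gs → ∀ k, k ≤ n → gs k = γ → gstar ≤ gs n :=
  topRunThresholds_of_runwisePSFloor β hγ (step_psFloor hβ γ) γ hγ le_rfl

/-- **(W) AT EVERY LEVEL** — runs of every length in every window, from the CEILING `1` alone (file 12's `windowRuns_of_betaUpperH`, p621368, BY NAME). [cite: Balaban1987RG1, (0.17)–(0.20) pp.255–256, §1 p.264 (elementary)] -/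
theorem step_windowRuns (hβ : ∀ (k : ℕ) (v : Fin (k + 1) → ℝ), β k v = if v 0 < c k then 1 else 0) (γ₀ : ℝ) :
    ∀ γ : ℝ, 0 < γ → γ ≤ γ₀ → ∀ K : ℕ, ∃ gs : ℕ → ℝ, RGEqH K β gs ∧ Step.InInterval γ K gs :=
  windowRuns_of_betaUpperH (step_upper hβ γ₀)

/-! ## §2 The END of `modelOf β`, BY HAND: the generated run in closed form and the fixed-point choice of the bare coupling -/

/-- the β read along the generated run from `x` at step `j` is the step `𝟙[x < c_j]` (the shape reads only `g_0 = x`). [folklore] -/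
theorem step_along_genSeq (hβ : ∀ (k : ℕ) (v : Fin (k + 1) → ℝ), β k v = if v 0 < c k then 1 else 0) (x : ℝ) (j : ℕ) :
    β j (prefixOf (genSeq β x) j) = if x < c j then 1 else 0 := by
  rw [hβ, prefixOf_apply, Fin.val_zero, genSeq_zero]

/-- **THE GENERATED RUN IN CLOSED FORM**: from a bare coupling `x > 0` with `#{i < K : x < c_i} < x⁻²`, the run generated by (0.20) is positive up to `K` and
`g_j⁻² = x⁻² − #{i < j : x < c_i}` (`j ≤ K`). [cite: Balaban1987RG1, (0.18)–(0.20) pp.255–256 (the recursion only; elementary)] -/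
theorem inv_sq_genSeq_step (hβ : ∀ (k : ℕ) (v : Fin (k + 1) → ℝ), β k v = if v 0 < c k then 1 else 0) {x : ℝ} (hx : 0 < x) {K : ℕ}
    (hK : ∑ i ∈ Finset.range K, (if x < c i then (1 : ℝ) else 0) < 1 / x ^ 2) :
    ∀ j, j ≤ K → 0 < genSeq β x j ∧ 1 / (genSeq β x j) ^ 2 = 1 / x ^ 2 - ∑ i ∈ Finset.range j, (if x < c i then (1 : ℝ) else 0) := by
  intro j hj
  induction j with
  | zero => exact ⟨by rw [genSeq_zero]; exact hx, by rw [genSeq_zero, Finset.sum_range_zero, sub_zero]⟩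
  | succ j ih =>
    obtain ⟨-, heq⟩ := ih (Nat.le_of_succ_le hj)
    have hmono : ∑ i ∈ Finset.range (j + 1), (if x < c i then (1 : ℝ) else 0) ≤ ∑ i ∈ Finset.range K, (if x < c i then (1 : ℝ) else 0) :=
      Finset.sum_le_sum_of_subset_of_nonneg (Finset.range_mono hj) fun i _ _ => by split_ifs <;> norm_num
    have harg : 0 < 1 / (genSeq β x j) ^ 2 - β j (prefixOf (genSeq β x) j) := by
      rw [heq, step_along_genSeq hβ x j]
      rw [Finset.sum_range_succ] at hmono
      linarith
    rw [genSeq_succ]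
    refine ⟨solveCoupling_pos harg, ?_⟩
    rw [inv_sq_solveCoupling harg, heq, step_along_genSeq hβ x j, Finset.sum_range_succ]
    ring

/-- … and it solves (0.20) up to `K`. [cite: Balaban1987RG1, (0.20) p.256 (elementary)] -/
theorem rgEqH_genSeq_step (hβ : ∀ (k : ℕ) (v : Fin (k + 1) → ℝ), β k v = if v 0 < c k then 1 else 0) {x : ℝ} (hx : 0 < x) {K : ℕ}
    (hK : ∑ i ∈ Finset.range K, (if x < c i then (1 : ℝ) else 0) < 1 / x ^ 2) : RGEqH K β (genSeq β x) := by
  intro k hk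
  obtain ⟨-, h1⟩ := inv_sq_genSeq_step hβ hx hK k hk.le
  obtain ⟨-, h2⟩ := inv_sq_genSeq_step hβ hx hK (k + 1) hk
  rw [h1, h2, step_along_genSeq hβ x k, Finset.sum_range_succ]
  ring

/-- A monotone self-map of `{0, …, K}` (here: `φ : ℕ → ℕ` monotone with `φ K ≤ K`) has a fixed point `≤ K` (the least `n` with `φ n ≤ n`). [folklore] -/
private theorem exists_fixedPoint_of_monotone_le {φ : ℕ → ℕ} (hφ : Monotone φ) {K : ℕ} (hK : φ K ≤ K) :
    ∃ n : ℕ, n ≤ K ∧ φ n = n := by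
  have hex : ∃ n, φ n ≤ n := ⟨K, hK⟩
  refine ⟨Nat.find hex, Nat.find_min' hex hK, ?_⟩
  have h1 : φ (Nat.find hex) ≤ Nat.find hex := Nat.find_spec hex
  by_contra hne
  have hlt : φ (Nat.find hex) < Nat.find hex := lt_of_le_of_ne h1 hne
  have h2 : Nat.find hex ≤ φ (Nat.find hex) := Nat.find_min' hex (hφ h1)
  exact absurd h2 (not_le.mpr hlt)

/-- ★ **THE STEP SHAPE'S MODEL CONSTRUCTION HAS THE END**: `EndpointExistence (modelOf β)` with `γ₂` arbitrary (here `1`) and `g⋆(γ) = γ`.  Given the target `0 < g ≤ γ` and the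
length `K`, put `x_n := (g⁻² + n)^{−1∕2}` and `φ n := #{i < K : x_n < c_i}` — monotone (`x_n` decreases in `n`) with `φ K ≤ K` — and take a fixed point `φ n = n`: the run generated from
`x_n` has `g_j⁻² = x_n⁻² − #{i < j : x_n < c_i} ≥ g⁻² ≥ γ⁻²` (so it stays in `]0, γ]`) and `g_K⁻² = x_n⁻² − n = g⁻²`, i.e. `g_K = g` EXACTLY.  No continuity and no non-crossing is
available or used. [cite: Balaban1987RG1, Thm 2 p.259 (first sentence), (0.17)–(0.20) pp.255–256 (elementary; nothing of the theorem asserted)] -/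
theorem endpointExistence_modelOf_step (hβ : ∀ (k : ℕ) (v : Fin (k + 1) → ℝ), β k v = if v 0 < c k then 1 else 0) :
    EndpointExistence (modelOf β) := by
  intro m
  refine ⟨1, one_pos, fun γ hγ _ => ⟨γ, hγ, fun g hg hgγ K => ?_⟩⟩
  -- the candidate bare couplings `x n = (g⁻² + n)^{-1/2}`
  have hApos : ∀ n : ℕ, 0 < 1 / g ^ 2 + n := fun n => by positivity
  have hxpos : ∀ n : ℕ, 0 < 1 / Real.sqrt (1 / g ^ 2 + n) := fun n => div_pos one_pos (Real.sqrt_pos.mpr (hApos n))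
  have hx_sq : ∀ n : ℕ, 1 / (1 / Real.sqrt (1 / g ^ 2 + n)) ^ 2 = 1 / g ^ 2 + n := fun n => by
    rw [div_pow, one_pow, Real.sq_sqrt (hApos n).le, one_div_one_div]
  have hx_anti : ∀ {n n' : ℕ}, n ≤ n' → 1 / Real.sqrt (1 / g ^ 2 + n') ≤ 1 / Real.sqrt (1 / g ^ 2 + n) := by
    intro n n' h
    have h' : (n : ℝ) ≤ n' := Nat.cast_le.mpr h
    exact one_div_le_one_div_of_le (Real.sqrt_pos.mpr (hApos n)) (Real.sqrt_le_sqrt (by linarith))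
  -- the monotone count and its fixed point
  have hφmono : Monotone fun n : ℕ => ((Finset.range K).filter fun i => 1 / Real.sqrt (1 / g ^ 2 + n) < c i).card := by
    intro n n' h
    refine Finset.card_le_card fun i hi => ?_
    rw [Finset.mem_filter] at hi ⊢
    exact ⟨hi.1, lt_of_le_of_lt (hx_anti h) hi.2⟩
  have hφK : ((Finset.range K).filter fun i => 1 / Real.sqrt (1 / g ^ 2 + (K : ℕ)) < c i).card ≤ K :=
    (Finset.card_filter_le _ _).trans (Finset.card_range K).le
  obtain ⟨n, -, hn⟩ := exists_fixedPoint_of_monotone_le hφmono hφK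
  set x : ℝ := 1 / Real.sqrt (1 / g ^ 2 + n) with hx_def
  have hx0 : 0 < x := hxpos n
  have hx_sq' : 1 / x ^ 2 = 1 / g ^ 2 + n := hx_sq n
  have hsum : ∑ i ∈ Finset.range K, (if x < c i then (1 : ℝ) else 0) = n := by
    rw [Finset.sum_boole, hn]
  have hK : ∑ i ∈ Finset.range K, (if x < c i then (1 : ℝ) else 0) < 1 / x ^ 2 := by
    rw [hsum, hx_sq']
    linarith [show (0 : ℝ) < 1 / g ^ 2 by positivity]
  have hγg : 1 / γ ^ 2 ≤ 1 / g ^ 2 := one_div_le_one_div_of_le (by positivity) (pow_le_pow_left₀ hg.le hgγ 2)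
  refine ⟨x, fun k hk => ?_, ?_⟩
  · -- the run stays in `]0, γ]`
    obtain ⟨hpos, heq⟩ := inv_sq_genSeq_step hβ hx0 hK k hk
    show 0 < genSeq β x k ∧ genSeq β x k ≤ γ
    refine ⟨hpos, ?_⟩
    have hle : ∑ i ∈ Finset.range k, (if x < c i then (1 : ℝ) else 0) ≤ n := by
      rw [← hsum]
      exact Finset.sum_le_sum_of_subset_of_nonneg (Finset.range_mono hk) fun i _ _ => by split_ifs <;> norm_num
    have h1 : 1 / γ ^ 2 ≤ 1 / (genSeq β x k) ^ 2 := by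
      rw [heq, hx_sq']
      linarith
    have h2 := (one_div_le_one_div (by positivity) (by positivity)).1 h1
    exact (pow_le_pow_iff_left₀ hpos.le hγ.le two_ne_zero).1 h2
  · -- … and ends EXACTLY at `g`
    obtain ⟨hpos, heq⟩ := inv_sq_genSeq_step hβ hx0 hK K le_rfl
    show genSeq β x K = g
    rw [hsum, hx_sq', add_sub_cancel_right] at heq
    have h2 : (genSeq β x K) ^ 2 = g ^ 2 := by
      have h3 := congrArg (fun t : ℝ => 1 / t) heq
      simpa only [one_div_one_div] using h3
    exact (pow_left_inj₀ hpos.le hg.le two_ne_zero).1 h2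

/-! ## §3 The letter that FAILS: run-wise (C) `SurvCont β γ₀` at EVERY level (hence box continuity too) -/

/-- by ROW (i) (p611987 `Ioc_subset_survivors_of_runConstRemainder_of_le` BY NAME) every survivor set contains an explicit initial interval: `]0, (γ⁻² + k)^{−1∕2}] ⊆ Survivors β γ k`.
[cite: Balaban1987RG1, Thm 3 p.264 (elementary consequence)] -/
theorem Ioc_subset_survivors_step (hβ : ∀ (k : ℕ) (v : Fin (k + 1) → ℝ), β k v = if v 0 < c k then 1 else 0) {γ : ℝ} (hγ : 0 < γ) (k : ℕ) :
    Set.Ioc 0 (1 / Real.sqrt (1 / γ ^ 2 + k)) ⊆ Survivors β γ k := by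
  have h := Ioc_subset_survivors_of_runConstRemainder_of_le (step_runConstRemainder hβ γ) (B := 1 / 2) (fun _ => le_rfl) hγ le_rfl k
  have e : (k : ℝ) * max (1 / 2 + 1 / 2) 0 = k := by norm_num
  rwa [e] at h

/-- ★ **RUN-WISE (C) FAILS AT LEVEL `γ₀` as soon as some threshold sits inside that level's survivor interval**: `0 < c k ≤ (γ₀⁻² + k)^{−1∕2}` ⟹ `¬ SurvCont β γ₀`.  By p611987
`survCont_iff_continuousOn_alongGenSeq` the trace of `β k` along the generated runs is the step `x ↦ 𝟙[x < c_k]` itself, asked to be continuous on a set containing `]0, c_k]`; at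
`c_k` its value is `0` and its values just below are `1`. [cite: Balaban1987RG1, §1 pp.263–264 (the continuity letter; here it fails for an abstract family — nothing about print's β)] -/
theorem not_survCont_step (hβ : ∀ (k : ℕ) (v : Fin (k + 1) → ℝ), β k v = if v 0 < c k then 1 else 0) {γ₀ : ℝ} (hγ₀ : 0 < γ₀) {k : ℕ} (hck : 0 < c k)
    (hck' : c k ≤ 1 / Real.sqrt (1 / γ₀ ^ 2 + k)) : ¬ SurvCont β γ₀ := by
  intro hC
  have hcont := ((survCont_iff_continuousOn_alongGenSeq β hγ₀).1 hC) k
  have hsub : Set.Ioc 0 (c k) ⊆ Survivors β γ₀ k := fun x hx => Ioc_subset_survivors_step hβ hγ₀ k ⟨hx.1, hx.2.trans hck'⟩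
  have hcw := hcont (c k) (hsub ⟨hck, le_rfl⟩)
  rw [Metric.continuousWithinAt_iff] at hcw
  obtain ⟨δ, hδ, hδ'⟩ := hcw 1 one_pos
  set x : ℝ := max (c k / 2) (c k - δ / 2) with hx_def
  have hx1 : x < c k := max_lt (by linarith) (by linarith)
  have hx0 : 0 < x := lt_of_lt_of_le (by linarith) (le_max_left _ _)
  have hdist : dist x (c k) < δ := by
    rw [Real.dist_eq, abs_sub_comm, abs_of_pos (by linarith)]
    linarith [le_max_right (c k / 2) (c k - δ / 2)]
  have h := hδ' (hsub ⟨hx0, hx1.le⟩) hdist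
  rw [step_along_genSeq hβ x k, step_along_genSeq hβ (c k) k, if_pos hx1, if_neg (lt_irrefl _), Real.dist_eq, sub_zero, abs_one] at h
  exact lt_irrefl _ h

/-- … hence BOX CONTINUITY `BetaContH γ₀ β` FAILS at every such level too (it would give `SurvCont`, `SurvCont.of_betaContH`). [cite: Balaban1987RG1, §1 pp.263–264 (the letter)] -/
theorem not_betaContH_step (hβ : ∀ (k : ℕ) (v : Fin (k + 1) → ℝ), β k v = if v 0 < c k then 1 else 0) {γ₀ : ℝ} (hγ₀ : 0 < γ₀) {k : ℕ} (hck : 0 < c k)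
    (hck' : c k ≤ 1 / Real.sqrt (1 / γ₀ ^ 2 + k)) : ¬ BetaContH γ₀ β :=
  fun h => not_survCont_step hβ hγ₀ hck hck' (SurvCont.of_betaContH hγ₀ h)

end Step

/-- **THRESHOLDS `c_k = 1∕(k+2)` REACH EVERY LEVEL**: for every `γ₀ > 0` some `k` (any `k ≥ γ₀⁻¹`) has `1∕(k+2) ≤ (γ₀⁻² + k)^{−1∕2}` (since `γ₀⁻² + k ≤ k² + k ≤ (k+2)²`). [folklore] -/
theorem exists_scale_step {γ₀ : ℝ} (hγ₀ : 0 < γ₀) : ∃ k : ℕ, (1 : ℝ) / ((k : ℝ) + 2) ≤ 1 / Real.sqrt (1 / γ₀ ^ 2 + k) := by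
  obtain ⟨k, hk⟩ := exists_nat_ge (1 / γ₀)
  refine ⟨k, one_div_le_one_div_of_le (Real.sqrt_pos.mpr (by positivity)) ?_⟩
  have h1 : 1 / γ₀ ^ 2 ≤ (k : ℝ) ^ 2 := by
    have := pow_le_pow_left₀ (by positivity) hk 2
    rwa [div_pow, one_pow] at this
  calc Real.sqrt (1 / γ₀ ^ 2 + k) ≤ Real.sqrt (((k : ℝ) + 2) ^ 2) := Real.sqrt_le_sqrt (by nlinarith)
    _ = (k : ℝ) + 2 := Real.sqrt_sq (by positivity)

/-! ## §4 The displays: everything END-side plus both pressed rows WITHOUT (C); with p611987, (C) is sufficient-not-necessary over the rows -/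

/-- ★★ **THE END, (W), (T), ROWS (i) AND (iv), NO-SHRINK, FLOOR `0` AND CEILING `1` AT EVERY LEVEL — WITHOUT RUN-WISE (C) AT ANY LEVEL — KERNEL WITNESS.**  One history-dependent family
`β` (the step shape with thresholds `1∕(k+2)`, instantiated here once) with `0 ≤ β ≤ 1` on every box, ROW (i) `RunConstRemainder β ½ ½ γ` at every level, ROW (iv) with `M = 0` at every
level, NO-(1+β₀)⁻¹-SHRINK at every level for every `β₀ ≥ 0`, (W) runs of every length in every window, (T) a top-run threshold at every level, and `EndpointExistence (modelOf β)` — for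
which DEF-1's run-wise (C) `SurvCont β γ₀` FAILS at EVERY level `γ₀ > 0`.  HONEST SCOPE: letter level only; at the route's `betaOfRecord₁₃ θ` NOTHING is claimed. [folklore] -/
theorem end_rows_noShrink_W_T_without_cont : ∃ β : HBeta,
    (∀ γ : ℝ, BetaLowerH 0 γ β) ∧ (∀ γ : ℝ, BetaUpperH 1 γ β) ∧
    (∀ γ : ℝ, RunConstRemainder β (fun _ => 1 / 2) (1 / 2) γ) ∧
    (∀ γ : ℝ, ∀ (n : ℕ) (gs : ℕ → ℝ), RGEqH n β gs → Step.InInterval γ n gs → ∀ k, k ≤ n → -(0 : ℝ) ≤ ∑ j ∈ Finset.Ico k n, β j (prefixOf gs j)) ∧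
    (∀ γ β₀ : ℝ, 0 ≤ β₀ →
      ∀ (n : ℕ) (gs : ℕ → ℝ), RGEqH n β gs → Step.InInterval γ n gs → ∀ m n', m < n' → n' ≤ n → gs m ≤ (1 + β₀) * gs n') ∧
    (∀ γ : ℝ, 0 < γ → ∀ K : ℕ, ∃ gs : ℕ → ℝ, RGEqH K β gs ∧ Step.InInterval γ K gs) ∧
    (∀ γ : ℝ, 0 < γ → ∃ gstar : ℝ, 0 < gstar ∧
      ∀ (n : ℕ) (gs : ℕ → ℝ), RGEqH n β gs → Step.InInterval γ n gs → ∀ k, k ≤ n → gs k = γ → gstar ≤ gs n) ∧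
    EndpointExistence (modelOf β) ∧
    (∀ γ₀ : ℝ, 0 < γ₀ → ¬ SurvCont β γ₀) := by
  have hβ : ∀ (k : ℕ) (v : Fin (k + 1) → ℝ),
      (fun k w => if w 0 < 1 / ((k : ℝ) + 2) then 1 else 0 : HBeta) k v = if v 0 < (fun k : ℕ => 1 / ((k : ℝ) + 2)) k then 1 else 0 := fun _ _ => rfl
  refine ⟨fun k w => if w 0 < 1 / ((k : ℝ) + 2) then 1 else 0, step_lower hβ, step_upper hβ, step_runConstRemainder hβ, step_psFloor hβ,
    fun γ _ hβ₀ => step_noShrink hβ γ hβ₀, fun γ hγ => step_windowRuns hβ γ γ hγ le_rfl, fun _ hγ => step_topRuns hβ hγ, endpointExistence_modelOf_step hβ,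
    fun γ₀ hγ₀ => ?_⟩
  obtain ⟨k, hk⟩ := exists_scale_step hγ₀
  exact not_survCont_step hβ hγ₀ (k := k) (by positivity) hk

/-- **COROLLARY — THE END DOES NOT PAY (C), EVEN GIVEN BOTH PRESSED ROWS**: a forward-generated, halting, currying construction WITH `EndpointExistence` whose floor-`0` β has ROW (i) and
ROW (iv) (`M = 0`) at every level and run-wise (C) at NO level. [folklore] -/
theorem exists_endpointExistence_rows_without_survCont : ∃ β : HBeta,
    EndpointExistence (modelOf β) ∧ (∀ γ : ℝ, RunConstRemainder β (fun _ => 1 / 2) (1 / 2) γ) ∧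
    (∀ γ : ℝ, ∀ (n : ℕ) (gs : ℕ → ℝ), RGEqH n β gs → Step.InInterval γ n gs → ∀ k, k ≤ n → -(0 : ℝ) ≤ ∑ j ∈ Finset.Ico k n, β j (prefixOf gs j)) ∧
    (∀ γ₀ : ℝ, 0 < γ₀ → ¬ SurvCont β γ₀) := by
  obtain ⟨β, -, -, hrem, hps, -, -, -, hE, hC⟩ := end_rows_noShrink_W_T_without_cont
  exact ⟨β, hE, hrem, hps, hC⟩

/-- ★ **(C) IS SUFFICIENT BUT NOT NECESSARY FOR THE END, OVER THE PRESSED ROWS — BY NAME.**  (a) p611987 `runRows_without_cont_not_endpointExistence`: a family with ROW (i), bounded `b`,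
ROW (iv) and NO `EndpointExistence` (Gaps' staircase; there (C) fails, and p611987 §5 shows rows + (C) ⟹ END, so (C) is what is missing); (b) THIS FILE: a family with ROW (i), ROW (iv)
AND `EndpointExistence` for which (C) fails at EVERY level.  Hence, as LETTERS on a general `HBeta`: the rows do not decide the END; adding (C) forces it (sufficient); the END does not
force (C) (not necessary).  HONEST: letter level only; print asserts continuity of the true β-functions ([I] §1), so at `betaOfRecord₁₃ θ` (C) is expected to hold — nothing here bears
on that. [folklore] -/
theorem survCont_sufficient_not_necessary_over_rows :
    (∃ (β : HBeta) (b : ℕ → ℝ) (r γ₀ B M : ℝ), 0 < γ₀ ∧ RunConstRemainder β b r γ₀ ∧ (∀ k, b k ≤ B) ∧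
      (∀ (n : ℕ) (gs : ℕ → ℝ), RGEqH n β gs → Step.InInterval γ₀ n gs → ∀ k, k ≤ n → -M ≤ ∑ j ∈ Finset.Ico k n, β j (prefixOf gs j)) ∧
      ¬ EndpointExistence (modelOf β)) ∧
    (∃ β : HBeta, EndpointExistence (modelOf β) ∧ (∀ γ : ℝ, RunConstRemainder β (fun _ => 1 / 2) (1 / 2) γ) ∧
      (∀ γ : ℝ, ∀ (n : ℕ) (gs : ℕ → ℝ), RGEqH n β gs → Step.InInterval γ n gs → ∀ k, k ≤ n → -(0 : ℝ) ≤ ∑ j ∈ Finset.Ico k n, β j (prefixOf gs j)) ∧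
      (∀ γ₀ : ℝ, 0 < γ₀ → ¬ SurvCont β γ₀)) :=
  ⟨runRows_without_cont_not_endpointExistence, exists_endpointExistence_rows_without_survCont⟩

end Summit.QuantumFields.YangMills.Theorems.BalabanUVNodesK1EndExactRowsContFreeStep

end
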